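import Summits.QuantumFields.BalabanUV.Beta.D1BFx.RoadEndBFxRecutShell
import Summits.QuantumFields.BalabanUV.Beta.D1BFx.GluonLegTails

/-!
# Road BF-x, END-TO-END OVER THE RE-CUT REST TABLE AT `gfrz`: far rows d0∕d1 AND the (α)-leaf `Spr (Ga n a)` DISCHARGED MODULO
# [B5, Prop. 1.2] ∧ [B5, (1.126)–(1.127)] BY NAME, h2∕d2 in shell currency — the road END whose only remaining leg HYPOTHESES are the two shell rows

HONEST DEPENDENCY (page 1, mandatory): continuum YM on T⁴ ⇐ BetaPertH ∧ nine spine estimates (0/9 proved); BetaPertH ⇐ (D1) ∧ (D4) ∧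
CAP+tail; G-an2-4 gates asym, D1 and NE2/3/4.  HONEST FRAMING (cell contract, verbatim): «discharging `BetaPertH` makes Bałaban's UV
stability UNCONDITIONAL — a real constructive-QFT result; it is NOT the continuum limit and NOT the Clay problem.»  THIS MODULE DISCHARGES
NOTHING of the wall: [folklore] composition of this lineage's `RoadEndBFxRecutShell.d1Drift_BFx_recut_shell` (p226473) with
`FrozenLegTails.far_rows_d0_d1_of_prop12` (the rows d0∕d1 of `gfrz`) and `GluonLegTails.hGa_of_prop12` (the (α)-leaf `Spr (Ga n a)`), both from
`B5.Prop12Printed`∕`B5.Kernel126_127Printed` BY NAME.  The two printed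
statements enter ONLY as the hypotheses `h12`∕`h126` — CONDITIONAL result; nothing printed is proved; no `Prop` minted; no cited fact restated;
0 sorry.  0 wall binders (hW∕hR∕D1Tel∕D1Rep = 0∕4); NOT D1, NOT `BetaPertH`, NOT continuum, NOT Clay.

ABSOLUTE RULE (cell charter, verbatim): «No internally-minted statement may enter as a cited fact. Every hypothesis is either kernel-proved in
this package or a verbatim quotation of a PUBLISHED theorem with page reference. The manuscript(s) under audit are NOT citable for their own
disputed steps — they are the thing under adjudication; programme-internal (2001/route/tribunal) claims are never citable.»

CONTENT.
* §1 [our object] `tailConst A₀ A₁ A₂ : ℕ → ℝ` (the END's envelope constants `A 0, A 1, A 2`).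
* §2 [folklore] **`d1Drift_BFx_recut_shell_of_prop12`** — EXACTLY `RoadEndBFxRecutShell.d1Drift_BFx_recut_shell` with its rows d0∕d1 (and their `A 0`,
  `A 1`, `δ`) AND its (α)-leaf `hGa` REPLACED by `h12 : B5.Prop12Printed (VectorTailsLoc.fam …)` and `h126 : B5.Kernel126_127Printed (VectorTailsLoc.kfam …)` for the family
  `FrozenLegTails.nOf`∕`MOf` (scale × even cubic volumes); the shell row `d2s` is asked at the caller's own rate `δ₂ > 0` and constant `A₂ ≥ 0`, the END
  runs at `δ := min δ₁ δ₂` (`δ₁` = the printed rate delivered by `far_rows_d0_d1_of_prop12`).  REMAINING LEG DEBT DISPLAYED: `h2s`, `d2s` only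
  (plus, unchanged: B1, (K), the slot-table sockets, `hdiv`, `hrowgh`, (REST′), (U)).
Unit `b2b-balaban-beta-d1-formalise-leaf-03` (gen 5), D1 formalisation swarm; `LEAVES-BFx.md` sub-row «FAR-d0d1@Prop12».
-/

noncomputable section

open Finset Filter Topology
open scoped BigOperators
open Literature.Probability.LatticeModels (annulus)
open Literature.MathematicalPhysics.QuantumFieldTheory.Balaban1983to89
open Literature.MathematicalPhysics.QuantumFieldTheory.Balaban1983to89.Beta
open OneStepResolventKernel (JetData)
open OneStepKernelFamily (TbalOf D1Drift)
open WindowIdentification (fullSum)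
open DyadicShell (Pt supNorm)
open ExpKernelCalculus (Site BiLoc shiftK)
open GhostTable (gFree)
open BubbleTransfer (unitVec)
open DressedMomentNormalisation (resSite)
open VectorTailsLoc (fam kfam)
open Summit.QuantumFields.BalabanUV.Beta.TameKernelCalculus (Spr)
open Summit.QuantumFields.BalabanUV.Beta.D1BFx.GluonLeg (Ga)
open Summit.QuantumFields.BalabanUV.Beta.D1BFx.ReducedKernel (TableR TOfRed)
open Summit.QuantumFields.BalabanUV.Beta.D1BFx.DressedTadpoleTable (tableRed)
open Summit.QuantumFields.BalabanUV.Beta.D1BFx.ReducedKernelSandwich (fineHess)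
open Summit.QuantumFields.BalabanUV.Beta.D1BFx.FineStencilBFBalaban (SbfBal)
open Summit.QuantumFields.BalabanUV.Beta.D1BFx.SecondStencilBF (Wbf)
open Summit.QuantumFields.BalabanUV.Beta.D1BFx.GhostKernelComplete (PghQ fineHessGhQ)
open Summit.QuantumFields.BalabanUV.Beta.D1BFx.FrozenLegProfile (gfrz)
open Summit.QuantumFields.BalabanUV.Beta.D1BFx.SplitInstance (RestIdx)
open Summit.QuantumFields.BalabanUV.Beta.D1BFx.SplitRecut (restK')
open Summit.QuantumFields.BalabanUV.Beta.D1BFx.RoadEndBFxRecut (cornerIdx)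
open Summit.QuantumFields.BalabanUV.Beta.D1BFx.RoadEndBFxRecutShell (d1Drift_BFx_recut_shell)
open Summit.QuantumFields.BalabanUV.Beta.D1BFx.FrozenLegTails (nOf MOf hn1 far_rows_d0_d1_of_prop12)
open Summit.QuantumFields.BalabanUV.Beta.D1BFx.GluonLegTails (hGa_of_prop12)

namespace Summit.QuantumFields.BalabanUV.Beta.D1BFx.RoadEndBFxRecutTails

/-! ## §1 Envelope constants -/

/-- [our object] the END's envelope constants packaged as one sequence: `0 ↦ A₀`, `1 ↦ A₁`, else `A₂`. -/
def tailConst (A₀ A₁ A₂ : ℝ) : ℕ → ℝ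
  | 0 => A₀
  | 1 => A₁
  | _ => A₂

/-- [folklore] all packaged constants are nonnegative when the three are. -/
theorem tailConst_nonneg {A₀ A₁ A₂ : ℝ} (h₀ : 0 ≤ A₀) (h₁ : 0 ≤ A₁) (h₂ : 0 ≤ A₂) : ∀ j, 0 ≤ tailConst A₀ A₁ A₂ j
  | 0 => h₀
  | 1 => h₁
  | (_ + 2) => h₂

/-! ## §2 The road END with d0∕d1 discharged modulo the printed B5 statements -/

variable {Lc : ℕ} [NeZero Lc] {a N : ℝ} {μ ν : Fin 4} {υ : Type*} [Fintype υ]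
  {cE cVH cΛ cR cK cQ cE₂ cJ4 cΛ₂ cR₂ cQ₂ x₀ ωgl ωgh : ℕ → ℝ} {WE WJ WΛ WR WQ : ℕ → TableR} {CE CJ CΛ CRt CQ δW : ℕ → ℝ}
  {Ru : υ → ℕ → ℝ} {CU : υ → ℝ} {CR : RestIdx → ℝ} {D₂ A₂ δ₂ U₁ : ℝ}

/-- [folklore] **ROAD BF-x, END TO END, RE-CUT TABLE AT `gfrz`, FAR ROWS d0∕d1 AND `Spr (Ga n a)` FROM [B5, Prop. 1.2] ∧ [B5, (1.126)–(1.127)] BY NAME,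
h2∕d2 IN SHELL CURRENCY.**  `RoadEndBFxRecutShell.d1Drift_BFx_recut_shell` with the rows d0∕d1 supplied by `FrozenLegTails.far_rows_d0_d1_of_prop12` and the
(α)-leaf `hGa` by `GluonLegTails.hGa_of_prop12`, from the two printed statements `h12`∕`h126` (hypotheses, NOT proved here); the shell rows `h2s` (constant
`D₂ ≥ 0`) and `d2s` (rate `δ₂ > 0`, constant `A₂ ≥ 0`) remain displayed, as do B1, (K) `hK`+`hω`+`hlam`, the slot-table sockets, `hdiv`, `hrowgh`, (REST′)
off the corner and (U) — verbatim. -/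
theorem d1Drift_BFx_recut_shell_of_prop12 (Js : ℕ → JetData 3 Lc) (hμν : μ ≠ ν) (hN : N ≠ 0) (hL : 2 ≤ Lc) (hodd : Odd Lc) (ha : 0 < a)
    (c : ℕ → ℝ) (hD₂ : 0 ≤ D₂) (hA₂ : 0 ≤ A₂) (hδ₂ : 0 < δ₂)
    -- the two PRINTED statements, by name, for the family scale × even cubic volumes
    (h12 : B5.Prop12Printed (fam nOf hn1 MOf a ha)) (h126 : B5.Kernel126_127Printed (kfam nOf MOf))
    -- the frozen profile's same-leg second differences, SHELL currency (the only far rows still displayed)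
    (h2s : ∀ n : ℕ, 2 ≤ n → ∀ [NeZero n], ∀ b ∈ (univ : Finset (Fin 4 → Fin n)).image resSite, ∀ r : ℕ, r + 1 ≤ n →
      ∑ v ∈ annulus 4 r (r + 1), |(gfrz n a b (v + unitVec ν + unitVec μ) - gFree (v + unitVec ν + unitVec μ)) -
          (gfrz n a b (v + unitVec ν) - gFree (v + unitVec ν)) - (gfrz n a b (v + unitVec μ) - gFree (v + unitVec μ)) +
          (gfrz n a b v - gFree v)| ≤ D₂ / (n : ℝ))
    (d2s : ∀ n : ℕ, 2 ≤ n → ∀ [NeZero n], ∀ b ∈ (univ : Finset (Fin 4 → Fin n)).image resSite, ∀ r : ℕ, n ≤ r →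
      ∑ v ∈ annulus 4 r (r + 1), |gfrz n a b (v + unitVec ν + unitVec μ) - gfrz n a b (v + unitVec ν) - gfrz n a b (v + unitVec μ) + gfrz n a b v| ≤
        A₂ * Real.exp (-(δ₂ / n) * ((r : ℝ) + 1)) / ((r : ℝ) + 1))
    -- bridge B1
    (hB1 : ∀ m : ℕ, 1 ≤ m → |(∑ j ∈ range m, B12Beta.secondMoment (TbalOf Lc Js j) μ ν) - c (Lc ^ m)| ≤ U₁)
    -- slot (K) with the loop-weight ratio and the PINNED normalisation (the (α)-leaf `Spr (Ga n a)` is `GluonLegTails.hGa_of_prop12`)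
    (hK : ∀ n : ℕ, 2 ≤ n → Odd n → ∀ [NeZero n], c n =
      ωgl n * B12Beta.secondMoment (TOfRed n a (SbfBal n a (cE n) (cVH n) (cΛ n) (cR n) (cK n) (cQ n))
        (tableRed n (Wbf (cE₂ n) (cJ4 n) (cΛ₂ n) (cR₂ n) (cQ₂ n) (WE n) (WJ n) (WΛ n) (WR n) (WQ n)))) μ ν
      + ωgh n * B12Beta.secondMoment (PghQ n a (x₀ n) (cK n) (cQ n)) μ ν + ∑ u, Ru u n)
    (hω : ∀ n : ℕ, 2 ≤ n → ωgh n * cK n ^ 2 = -2 * (ωgl n * cE n ^ 2)) (hlam : ∀ n : ℕ, 2 ≤ n → ωgl n * cE n ^ 2 = 2 * N ^ 2 * (n : ℝ) ^ 8)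
    -- slot-table sockets
    (hδW : ∀ n, 0 < δW n)
    (hE : ∀ n κ u l u', BiLoc (WE n κ u l u') u u' (CE n) (δW n)) (hJ : ∀ n κ u l u', BiLoc (WJ n κ u l u') u u' (CJ n) (δW n))
    (hΛ : ∀ n κ u l u', BiLoc (WΛ n κ u l u') u u' (CΛ n) (δW n)) (hR : ∀ n κ u l u', BiLoc (WR n κ u l u') u u' (CRt n) (δW n))
    (hQ : ∀ n κ u l u', BiLoc (WQ n κ u l u') u u' (CQ n) (δW n))
    (hEc : ∀ (n : ℕ) (κ : Fin 4) (u : Site 4) (l : Fin 4) (u' t : Site 4),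
      WE n κ (u + (n : ℤ) • t) l (u' + (n : ℤ) • t) = shiftK (-((n : ℤ) • t)) (WE n κ u l u'))
    (hJc : ∀ (n : ℕ) (κ : Fin 4) (u : Site 4) (l : Fin 4) (u' t : Site 4),
      WJ n κ (u + (n : ℤ) • t) l (u' + (n : ℤ) • t) = shiftK (-((n : ℤ) • t)) (WJ n κ u l u'))
    (hΛc : ∀ (n : ℕ) (κ : Fin 4) (u : Site 4) (l : Fin 4) (u' t : Site 4),
      WΛ n κ (u + (n : ℤ) • t) l (u' + (n : ℤ) • t) = shiftK (-((n : ℤ) • t)) (WΛ n κ u l u'))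
    (hRc : ∀ (n : ℕ) (κ : Fin 4) (u : Site 4) (l : Fin 4) (u' t : Site 4),
      WR n κ (u + (n : ℤ) • t) l (u' + (n : ℤ) • t) = shiftK (-((n : ℤ) • t)) (WR n κ u l u'))
    (hQc : ∀ (n : ℕ) (κ : Fin 4) (u : Site 4) (l : Fin 4) (u' t : Site 4),
      WQ n κ (u + (n : ℤ) • t) l (u' + (n : ℤ) • t) = shiftK (-((n : ℤ) • t)) (WQ n κ u l u'))
    (hEs : ∀ n κ u l u', WE n κ u l u' = WE n l u' κ u) (hJs : ∀ n κ u l u', WJ n κ u l u' = WJ n l u' κ u)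
    (hΛs : ∀ n κ u l u', WΛ n κ u l u' = WΛ n l u' κ u) (hRs : ∀ n κ u l u', WR n κ u l u' = WR n l u' κ u)
    (hQs : ∀ n κ u l u', WQ n κ u l u' = WQ n l u' κ u)
    -- first-bond divergence-freeness of the gluon fine Hessian kernel; the ghost Ward rows
    (hdiv : ∀ n : ℕ, 2 ≤ n → ∀ [NeZero n], ∀ (l' : Fin 4) (u' u : Site 4), ∑ κ' : Fin 4,
      (fineHess n a (SbfBal n a (cE n) (cVH n) (cΛ n) (cR n) (cK n) (cQ n))
          (Wbf (cE₂ n) (cJ4 n) (cΛ₂ n) (cR₂ n) (cQ₂ n) (WE n) (WJ n) (WΛ n) (WR n) (WQ n)) κ' l' (u - Pi.single κ' 1) u'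
        - fineHess n a (SbfBal n a (cE n) (cVH n) (cΛ n) (cR n) (cK n) (cQ n))
          (Wbf (cE₂ n) (cJ4 n) (cΛ₂ n) (cR₂ n) (cQ₂ n) (WE n) (WJ n) (WΛ n) (WR n) (WQ n)) κ' l' u u') = 0)
    (hrowgh : ∀ n : ℕ, 2 ≤ n → ∀ [NeZero n], ∀ (κ' l' : Fin 4) (b : Site 4), HasSum (fineHessGhQ n a (x₀ n) (cK n) (cQ n) κ' l' b) 0)
    -- (REST′) for the re-cut words other than the corner, n-UNIFORM; (U)
    (hRest : ∀ n : ℕ, 2 ≤ n → ∀ [NeZero n], ∀ τ : RestIdx, τ ≠ cornerIdx →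
      |∑ b ∈ (univ : Finset (Fin 4 → Fin n)).image resSite, ((n : ℝ) ^ 4)⁻¹ *
        fullSum (fun w : Pt => restK' n a (gfrz n a b) (cE n) (cΛ n) (cR n) (cK n) (cQ n) (cE₂ n) (cJ4 n) (cΛ₂ n) (cR₂ n) (cQ₂ n) (x₀ n)
          (WE n) (WJ n) (WΛ n) (WR n) (WQ n) (ωgl n) (ωgh n) ((n : ℝ) ^ 8) N μ ν b τ w)| ≤ CR τ)
    (hU : ∀ n : ℕ, 2 ≤ n → ∀ u, |Ru u n| ≤ CU u) :
    D1Drift Lc Js N μ ν := by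
  obtain ⟨δ₁, A₀, A₁, hδ₁, hA₀, hA₁, hd0, hd1⟩ := far_rows_d0_d1_of_prop12 ha h12 h126
  have hδ : 0 < min δ₁ δ₂ := lt_min hδ₁ hδ₂
  refine d1Drift_BFx_recut_shell (A := tailConst A₀ A₁ A₂) (δ := min δ₁ δ₂) Js hμν hN hL hodd ha c hD₂ (tailConst_nonneg hA₀ hA₁ hA₂) hδ h2s
    ?_ ?_ ?_ hB1 (hGa_of_prop12 ha h12 h126) hK hω hlam hδW hE hJ hΛ hR hQ hEc hJc hΛc hRc hQc hEs hJs hΛs hRs hQs hdiv hrowgh hRest hU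
  · -- d0 at the slower rate (`gcongr` knows `Real.exp_le_exp`)
    intro n hn _ b hb v hv
    refine (hd0 n hn b hb v hv).trans ?_
    show A₀ * Real.exp (-(δ₁ / n) * supNorm v) / (supNorm v : ℝ) ^ 2 ≤ A₀ * Real.exp (-(min δ₁ δ₂ / n) * supNorm v) / (supNorm v : ℝ) ^ 2
    gcongr
    exact min_le_left _ _
  · -- d1 at the slower rate
    intro n hn _ b hb v hv ρ
    refine (hd1 n hn b hb v hv ρ).trans ?_
    show A₁ * Real.exp (-(δ₁ / n) * supNorm v) / (supNorm v : ℝ) ^ 3 ≤ A₁ * Real.exp (-(min δ₁ δ₂ / n) * supNorm v) / (supNorm v : ℝ) ^ 3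
    gcongr
    exact min_le_left _ _
  · -- d2s at the slower rate
    intro n hn _ b hb r hr
    refine (d2s n hn b hb r hr).trans ?_
    show A₂ * Real.exp (-(δ₂ / n) * ((r : ℝ) + 1)) / ((r : ℝ) + 1) ≤
      A₂ * Real.exp (-(min δ₁ δ₂ / n) * ((r : ℝ) + 1)) / ((r : ℝ) + 1)
    gcongr
    exact min_le_right _ _

end Summit.QuantumFields.BalabanUV.Beta.D1BFx.RoadEndBFxRecutTails

end
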